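import Literature.MathematicalPhysics.QuantumFieldTheory.BalabanImbrieJaffe1984to88.BIJ88EndChainNFluct309

/-!
# `BalabanImbrieJaffe1984to88.BIJ88EndChainNFluctSource309` — T. Bałaban, J. Imbrie, A. Jaffe, *Effective action and cluster properties of the
abelian Higgs model*, Commun. Math. Phys. **114** (1988) 257–315 [BalabanImbrieJaffe1988], Sect. 5.13 p. 305–307 [PDF 49–51] with Sect. 5.14
(5.14.4) p. 309–310 [PDF 53–54] and [Balaban1982Higgs2] (2.28)–(2.29) p. 563: **THE FAR-CUBE FLUCTUATION BOUND ON END-DECORATED CHAINS WITH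
SOURCES** — `BIJ88EndChainNFluct309.fluct_le_chainN` (sourceless class `ℱ = 0`) extended to the Gaussian measures WITH A LINEAR SOURCE `ℱ`
(the §5.13 measures `dμ ∝ e^{−½⟨φ,Δ_sφ⟩ + ⟨ℱ,φ⟩}` of the model carry the background/source term `ℱ`; the head of row C2.Eq5.14.5 quantifies over
it).  With a source the conditional mean of the field off the observable's cube `□_a` has the DRIFT `d = A_Λ⁻¹ℱ↾Λ` and the field on `□_a` the mean
`m = A⁻¹ℱ`; print's (2.29) majorant `BIJ88DexpCondMeanMajorant305.expect_abs_Dfun_cm_sub_le` then carries, besides the second-order term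
`R_x·Σ_k|T_{xk}|M_k` (`M_k = (A⁻¹)_{kk} + m_k²`), the FIRST-ORDER drift terms `|d_x|·Σ_k|T_{yk}|(1+M_k)/2`.  The letters paying them (print p. 305:
*"Using the theorem on unit lattice operators in [6], we can invert this operator to yield an exponentially decaying covariance C_s"* — an
exponentially decaying kernel is a bounded operator on `ℓ^∞`): **(c)** the absolute row sums of the restricted and of the full interpolated
inverse are `≤ c₂` (derived from `Δ`-letters by Combes–Thomas in `BIJ88Ineq5144EndChainNSource`, this generation), and the pointwise source
bound `|ℱ_x| ≤ F`; so `|d_x|, |m_k| ≤ c₂F`, `M_k ≤ 1/m + (c₂F)² =: μ`, and with the rows `Σ_k|T_{xk}| ≤ ρ = W·c₁δ^D·R` of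
`BIJ88EndChainNFluct309.rowSum_boundary_le_chainN`:

  `⟨|D_n∘cm − D_n(cm₀)|⟩_s ≤ W·R·ρ·(ρ·μ + c₂F·(1 + μ))`      (`fluct_le_chainN_source`),

FIRST order in `ρ`, i.e. ONE factor `δ^D = e^{−cr(e_k)·D}` for the `D` cubes crossed — print's count (p. 310: *"The others, localized in region X, have
a factor of e^{−cr(e_k)|X|}"*).

statement-level skeleton of published theorems with citation tags; proofs where landed; nothing here is a claim about the Yang–Mills mass gap

PDF held: `paper:balaban1988-cmp114-bij-abelian-higgs-effective-action` (journal page = PDF page + 256); p. 305 (p0049 L17–18), p. 307 (p0051), p. 310 (p0054)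
as quoted.

WHAT IS PROVED (unit `lit-balaban-p36`, generation 20 of the Phase-2 proof seat p36; SKELETON rows C2.Eq5.14.3-5.14.4 / C2.Eq5.13.3-5.13.4 of
`HOME/lit-balaban-r16/ROWS-C2-part2.md`, owner r16; 0 definitions, 0 `Prop` facts, theorems only).
* `majorant_le_of_rows_drift` (the bookkeeping of the majorant WITH drift: `≤ Σ w·ρ(ρμ + d̄(1+μ))`), `abs_mulVec_le_of_rowSum` (`|(Mv)_i| ≤ c₂F`),
  **`fluct_le_chainN_source`**.
HONEST SCOPE: letters (b), (c), W, R, `|ℱ| ≤ F`, the neighbour and depth clauses are hypotheses (all derived from `Δ`-letters and lattice geometry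
in the instance file's Combes–Thomas variant, except W, R, F which are primitive); nothing is claimed about middle-decorated or χ-decorated polymers.
Imports `BIJ88EndChainNFluct309` (p36 g20); modifies nothing.  NOT summit progress; NOT continuum; NOT Clay.  Cell `lit-balaban` Phase 2, seat p36
gen 20 (owner r16, referee ref-5).
-/

noncomputable section

open Finset MeasureTheory Matrix Function Filter
open Literature.MathematicalPhysics.QuantumFieldTheory.Balaban1983to89
open Literature.MathematicalPhysics.QuantumFieldTheory.BalabanImbrieJaffe1984to88
open B2Eq228Conditioning (In Out resIn resOut glue blkIn blkMix condShift)
open BIJ88DirichletForms305 (interpForm interpForm_apply interpForm_posDef quadForm_interpForm_ge)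
open BIJ88PolymerRep5134 (corner)
open BIJ88PolymerRep5134GaussWitness (corner_mem_cube)
open BIJ88SecondOrder5133 (num Dfun)
open BIJ88ExpectTilt305 (inv_apply_self_le)
open BIJ88DexpCondMeanMajorant305 (expect_abs_Dfun_cm_sub_le)
open BIJ88EndChainFluct309 (abs_interpForm_apply_le interpForm_apply_eq_zero sum_sum_abs_le)
open BIJ88EndChainNFluct309 (rowSum_boundary_le_chainN)

namespace Literature.MathematicalPhysics.QuantumFieldTheory.BalabanImbrieJaffe1984to88.BIJ88EndChainNFluctSource309

variable {α I : Type} [Fintype α] [DecidableEq α] [Fintype I] [DecidableEq I] (blk : α → I) {Δ : Matrix α α ℝ}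

/-! ## §1 The bookkeeping of the majorant with drift -/

omit [Fintype I] in
/-- **the bookkeeping of the majorant WITH DRIFT** (`BIJ88DexpCondMeanMajorant305.expect_abs_Dfun_cm_sub_le`, its right side verbatim): with
second moments `≤ μ`, rows `Σ_k|T_{xk}| ≤ ρ` and drifts `|d_x| ≤ d̄` for `x ∈ □_n` and for the `x` satisfying `Q`, and coefficients vanishing off
`Q`, the majorant is `≤ (Σ_{x∈□_n, y} w_{xy})·ρ(ρμ + d̄(1+μ))`. [cite: BalabanImbrieJaffe1988, §5.13 p.307] [cite: Balaban1982Higgs2, (2.29) p.563] -/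
theorem majorant_le_of_rows_drift (p : α → Prop) [DecidablePred p] (s : I → ℝ) (n : I) (A₀ A : Matrix α α ℝ) (T : Matrix (In p) (Out p) ℝ)
    (d : In p → ℝ) (m : α → ℝ) {μ : ℝ} (hμ : 0 ≤ μ) (hm : ∀ k : Out p, A⁻¹ k.1 k.1 + m k.1 ^ 2 ≤ μ)
    (hm0 : ∀ k : Out p, 0 ≤ A⁻¹ k.1 k.1 + m k.1 ^ 2) (Q : In p → Prop) {ρ : ℝ} (hρ : 0 ≤ ρ)
    (hrow : ∀ x : In p, (blk x.1 = n ∨ Q x) → ∑ k, |T x k| ≤ ρ) {dB : ℝ} (hdB0 : 0 ≤ dB)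
    (hdB : ∀ x : In p, (blk x.1 = n ∨ Q x) → |d x| ≤ dB) (w : In p → In p → ℝ) (hw0 : ∀ i j, 0 ≤ w i j)
    (hpref : ∀ i j : In p, blk i.1 = n → blk j.1 ≠ n → |s (blk j.1) * A₀ i.1 j.1| ≤ w i j)
    (hzero : ∀ i j : In p, blk i.1 = n → blk j.1 ≠ n → ¬ Q j → s (blk j.1) * A₀ i.1 j.1 = 0) :
    ∑ i : In p, ∑ j : In p, |(if blk i = n ∧ blk j ≠ n then s (blk j) * A₀ i j else 0)| *
        ((1 / 2) * ((∑ k, |T i k|) * ∑ k, |T i k| * (A⁻¹ k k + m k ^ 2) + (∑ k, |T j k|) * ∑ k, |T j k| * (A⁻¹ k k + m k ^ 2))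
          + |d i| * ∑ k, |T j k| * ((1 + (A⁻¹ k k + m k ^ 2)) / 2)
          + |d j| * ∑ k, |T i k| * ((1 + (A⁻¹ k k + m k ^ 2)) / 2))
      ≤ ∑ i : In p, ∑ j : In p, (if blk i.1 = n ∧ blk j.1 ≠ n then w i j else 0) * (ρ * (ρ * μ + dB * (1 + μ))) := by
  refine sum_le_sum fun i _ => sum_le_sum fun j _ => ?_
  -- the weighted rows
  have hS : ∀ x : In p, (blk x.1 = n ∨ Q x) → (∑ k, |T x k|) * ∑ k, |T x k| * (A⁻¹ k.1 k.1 + m k.1 ^ 2) ≤ ρ ^ 2 * μ := by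
    intro x hx
    have h0 : 0 ≤ ∑ k, |T x k| := sum_nonneg fun _ _ => abs_nonneg _
    have h1 : ∑ k, |T x k| * (A⁻¹ k.1 k.1 + m k.1 ^ 2) ≤ (∑ k, |T x k|) * μ := by
      rw [sum_mul]; exact sum_le_sum fun k _ => mul_le_mul_of_nonneg_left (hm k) (abs_nonneg _)
    calc (∑ k, |T x k|) * ∑ k, |T x k| * (A⁻¹ k.1 k.1 + m k.1 ^ 2) ≤ (∑ k, |T x k|) * ((∑ k, |T x k|) * μ) :=
          mul_le_mul_of_nonneg_left h1 h0
      _ = (∑ k, |T x k|) ^ 2 * μ := by ring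
      _ ≤ ρ ^ 2 * μ := mul_le_mul_of_nonneg_right (pow_le_pow_left₀ h0 (hrow x hx) 2) hμ
  have hS0 : ∀ x : In p, 0 ≤ (∑ k, |T x k|) * ∑ k, |T x k| * (A⁻¹ k.1 k.1 + m k.1 ^ 2) := fun x =>
    mul_nonneg (sum_nonneg fun _ _ => abs_nonneg _) (sum_nonneg fun k _ => mul_nonneg (abs_nonneg _) (hm0 k))
  -- the drift rows
  have hU : ∀ x : In p, (blk x.1 = n ∨ Q x) → ∑ k, |T x k| * ((1 + (A⁻¹ k.1 k.1 + m k.1 ^ 2)) / 2) ≤ ρ * ((1 + μ) / 2) := by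
    intro x hx
    have h1 : ∑ k, |T x k| * ((1 + (A⁻¹ k.1 k.1 + m k.1 ^ 2)) / 2) ≤ (∑ k, |T x k|) * ((1 + μ) / 2) := by
      rw [sum_mul]
      exact sum_le_sum fun k _ => mul_le_mul_of_nonneg_left (by linarith [hm k]) (abs_nonneg _)
    exact h1.trans (mul_le_mul_of_nonneg_right (hrow x hx) (by linarith))
  have hU0 : ∀ x : In p, 0 ≤ ∑ k, |T x k| * ((1 + (A⁻¹ k.1 k.1 + m k.1 ^ 2)) / 2) := fun x =>
    sum_nonneg fun k _ => mul_nonneg (abs_nonneg _) (by linarith [hm0 k])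
  have hC0 : 0 ≤ ρ * (ρ * μ + dB * (1 + μ)) := by positivity
  by_cases hc : blk i.1 = n ∧ blk j.1 ≠ n
  · rw [if_pos hc, if_pos hc]
    by_cases hq : Q j
    · have hi := hS i (Or.inl hc.1)
      have hj := hS j (Or.inr hq)
      have hdi : |d i| * ∑ k, |T j k| * ((1 + (A⁻¹ k.1 k.1 + m k.1 ^ 2)) / 2) ≤ dB * (ρ * ((1 + μ) / 2)) :=
        mul_le_mul (hdB i (Or.inl hc.1)) (hU j (Or.inr hq)) (hU0 j) hdB0
      have hdj : |d j| * ∑ k, |T i k| * ((1 + (A⁻¹ k.1 k.1 + m k.1 ^ 2)) / 2) ≤ dB * (ρ * ((1 + μ) / 2)) :=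
        mul_le_mul (hdB j (Or.inr hq)) (hU i (Or.inl hc.1)) (hU0 i) hdB0
      refine mul_le_mul (hpref i j hc.1 hc.2) ?_ ?_ (hw0 i j)
      · calc _ ≤ (1 / 2) * (ρ ^ 2 * μ + ρ ^ 2 * μ) + dB * (ρ * ((1 + μ) / 2)) + dB * (ρ * ((1 + μ) / 2)) := by
              linarith [hi, hj, hdi, hdj]
          _ = ρ * (ρ * μ + dB * (1 + μ)) := by ring
      · exact add_nonneg (add_nonneg (mul_nonneg (by norm_num) (add_nonneg (hS0 i) (hS0 j))) (mul_nonneg (abs_nonneg _) (hU0 j)))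
          (mul_nonneg (abs_nonneg _) (hU0 i))
    · rw [hzero i j hc.1 hc.2 hq, abs_zero, zero_mul]
      exact mul_nonneg (hw0 i j) hC0
  · rw [if_neg hc, if_neg hc, abs_zero, zero_mul, zero_mul]

/-- `|(Mv)_i| ≤ c₂·F` when the `i`-th absolute row sum of `M` is `≤ c₂` and `|v| ≤ F` pointwise. [folklore] [cite: BalabanImbrieJaffe1988, §5.13 p.305] -/
theorem abs_mulVec_le_of_rowSum {β β' : Type} [Fintype β'] (M : Matrix β β' ℝ) (v : β' → ℝ) {F : ℝ} (hF0 : 0 ≤ F) (hF : ∀ l, |v l| ≤ F)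
    {c₂ : ℝ} (i : β) (hrow : ∑ l, |M i l| ≤ c₂) : |(M *ᵥ v) i| ≤ c₂ * F := by
  calc |(M *ᵥ v) i| = |∑ l, M i l * v l| := rfl
    _ ≤ ∑ l, |M i l| * |v l| := (abs_sum_le_sum_abs _ _).trans (le_of_eq (sum_congr rfl fun l _ => abs_mul _ _))
    _ ≤ ∑ l, |M i l| * F := sum_le_sum fun l _ => mul_le_mul_of_nonneg_left (hF l) (abs_nonneg _)
    _ = (∑ l, |M i l|) * F := by rw [sum_mul]
    _ ≤ c₂ * F := mul_le_mul_of_nonneg_right hrow hF0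

/-! ## §2 The fluctuation of the far cube's pulled-down factor with a source -/

/-- **`⟨|D_n∘cm − D_n(cm₀)|⟩_s ≤ W·R·ρ·(ρ·μ + c₂F·(1 + μ))`, `ρ = W·c₁δ^D·R`, `μ = 1/m + (c₂F)²`, on an end-decorated chain WITH SOURCE `ℱ`**
(`Δ ≻ 0`, `Δ ≥ m·1`; `□_n` not coupled to `□_a`; `□_b` the only cube of `X″ ∖ {a}` coupled to `□_a`; W, R; the decay letter (b) at `s`; the
row-sum letter (c) for the restricted and the full interpolated inverse at `s`; `|ℱ| ≤ F`; depth `D`; `s ∈ [0,1]^I` supported in `X″`): the majorant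
`expect_abs_Dfun_cm_sub_le` WITH its drift terms (`|d_x| ≤ c₂F`), `M_k = (Δ_s⁻¹)_{kk} + (Δ_s⁻¹ℱ)_k² ≤ 1/m + (c₂F)²`, the pairs `x ∈ □_n`, `y` a site
of an `X″`-cube coupled to `□_n` (`≤ W·R` in `|Δ_{xy}|`-weight) and the rows of `T` bounded by `rowSum_boundary_le_chainN`.
[cite: BalabanImbrieJaffe1988, §5.13 p.305, p.307; (5.14.4) p.309–310] [cite: Balaban1982Higgs2, (2.29) p.563] -/
theorem fluct_le_chainN_source (hΔ : Δ.PosDef) {m : ℝ} (hm : 0 < m) (hΔm : ∀ φ : α → ℝ, m * (φ ⬝ᵥ φ) ≤ φ ⬝ᵥ (Δ *ᵥ φ)) (ℱ : α → ℝ)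
    {a b n : I} (hab : a ≠ b) (han : a ≠ n) (X'' : Finset I) (hfar : ∀ x y, blk x = n → blk y = a → Δ x y = 0)
    (hnbr : ∀ l k, blk l ∈ X'' → blk l ≠ a → blk k = a → Δ l k ≠ 0 → blk l = b)
    {W : ℕ} (hW : ∀ i, (univ.filter fun x : α => blk x = i).card ≤ W)
    {R : ℝ} (hR0 : 0 ≤ R) (hR : ∀ x, ∑ y ∈ univ.filter (fun y => blk y ≠ blk x), |Δ x y| ≤ R)
    (ds : α → α → ℕ) {c₁ δ : ℝ} (hc₁ : 0 ≤ c₁) (hδ0 : 0 ≤ δ) (hδ1 : δ ≤ 1) (D : ℕ)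
    (hgeo : ∀ x l, (blk x = n ∨ (blk x ∈ X'' ∧ ∃ y, blk y = n ∧ Δ y x ≠ 0)) → blk l = b → (∃ k, blk k = a ∧ Δ l k ≠ 0) → D ≤ ds x l)
    (Λc : Finset I) {s : I → ℝ} (hs : ∀ l, 0 ≤ s l ∧ s l ≤ 1) (hs0 : ∀ l, l ∉ X'' → s l = 0)
    (hdec : ∀ x l : In (fun x => blk x ≠ a),
      |(blkIn (fun x => blk x ≠ a) (interpForm blk (interpForm blk Δ (corner ℝ Λc)) s))⁻¹ x l| ≤ c₁ * δ ^ ds x.1 l.1)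
    -- the source letters: `|ℱ| ≤ F`; absolute row sums of the restricted and of the full interpolated inverse `≤ c₂`
    {F : ℝ} (hF0 : 0 ≤ F) (hF : ∀ x, |ℱ x| ≤ F) {c₂ : ℝ} (hc₂ : 0 ≤ c₂)
    (hrowΛ : ∀ x : In (fun x => blk x ≠ a),
      ∑ l, |(blkIn (fun x => blk x ≠ a) (interpForm blk (interpForm blk Δ (corner ℝ Λc)) s))⁻¹ x l| ≤ c₂)
    (hrowA : ∀ k, blk k = a → ∑ l, |(interpForm blk (interpForm blk Δ (corner ℝ Λc)) s)⁻¹ k l| ≤ c₂) :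
    num blk (interpForm blk Δ (corner ℝ Λc)) ℱ (fun φ => |Dfun blk (interpForm blk Δ (corner ℝ Λc)) s n
          (glue (fun x => blk x ≠ a) (condShift (fun x => blk x ≠ a) (interpForm blk (interpForm blk Δ (corner ℝ Λc)) s) ℱ
            (resOut (fun x => blk x ≠ a) φ)) (resOut (fun x => blk x ≠ a) φ))
        - Dfun blk (interpForm blk Δ (corner ℝ Λc)) s n
          (glue (fun x => blk x ≠ a) ((blkIn (fun x => blk x ≠ a) (interpForm blk (interpForm blk Δ (corner ℝ Λc)) s))⁻¹ *ᵥ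
            resIn (fun x => blk x ≠ a) ℱ) 0)|) s
        / num blk (interpForm blk Δ (corner ℝ Λc)) ℱ (fun _ => 1) s
      ≤ W * R * ((W * (c₁ * δ ^ D * R)) * ((W * (c₁ * δ ^ D * R)) * (m⁻¹ + (c₂ * F) ^ 2) +
          c₂ * F * (1 + (m⁻¹ + (c₂ * F) ^ 2)))) := by
  have hcs := corner_mem_cube (I := I) Λc
  have hΔc : (interpForm blk Δ (corner ℝ Λc)).PosDef := interpForm_posDef blk hΔ hcs
  have hmΔc : ∀ φ : α → ℝ, m * (φ ⬝ᵥ φ) ≤ φ ⬝ᵥ (interpForm blk Δ (corner ℝ Λc) *ᵥ φ) := quadForm_interpForm_ge blk hΔm hcs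
  have hA : (interpForm blk (interpForm blk Δ (corner ℝ Λc)) s).PosDef := interpForm_posDef blk hΔc hs
  have hmA : ∀ v : α → ℝ, m * (v ⬝ᵥ v) ≤ v ⬝ᵥ (interpForm blk (interpForm blk Δ (corner ℝ Λc)) s *ᵥ v) :=
    quadForm_interpForm_ge blk hmΔc hs
  have hPn : ∀ x, blk x = n → (fun x => blk x ≠ a) x := fun x hx h => han (h.symm.trans hx)
  have hfar' : ∀ x y, blk x = n → ¬ (fun x => blk x ≠ a) y → interpForm blk Δ (corner ℝ Λc) x y = 0 :=
    fun x y hx hy => interpForm_apply_eq_zero blk Δ _ (hfar x y hx (not_ne_iff.1 hy))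
  have hmaj := expect_abs_Dfun_cm_sub_le blk hΔc ℱ hs (fun x => blk x ≠ a) hPn hfar'
    (interpForm blk (interpForm blk Δ (corner ℝ Λc)) s) rfl
    ((blkIn (fun x => blk x ≠ a) (interpForm blk (interpForm blk Δ (corner ℝ Λc)) s))⁻¹ *
      blkMix (fun x => blk x ≠ a) (interpForm blk (interpForm blk Δ (corner ℝ Λc)) s)) rfl
    ((blkIn (fun x => blk x ≠ a) (interpForm blk (interpForm blk Δ (corner ℝ Λc)) s))⁻¹ *ᵥ resIn (fun x => blk x ≠ a) ℱ) rfl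
    ((interpForm blk (interpForm blk Δ (corner ℝ Λc)) s)⁻¹ *ᵥ ℱ) rfl
  refine hmaj.trans ?_
  -- the drift and the mean: `|d_x|, |m_k| ≤ c₂F`
  have hdB : ∀ x : In (fun x => blk x ≠ a),
      |((blkIn (fun x => blk x ≠ a) (interpForm blk (interpForm blk Δ (corner ℝ Λc)) s))⁻¹ *ᵥ resIn (fun x => blk x ≠ a) ℱ) x| ≤
        c₂ * F := fun x =>
    abs_mulVec_le_of_rowSum _ (resIn (fun x => blk x ≠ a) ℱ) hF0 (fun l => hF l.1) x (hrowΛ x)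
  have hmk : ∀ k : Out (fun x => blk x ≠ a), |((interpForm blk (interpForm blk Δ (corner ℝ Λc)) s)⁻¹ *ᵥ ℱ) k.1| ≤ c₂ * F := fun k =>
    abs_mulVec_le_of_rowSum _ _ hF0 hF k.1 (hrowA k.1 (not_ne_iff.1 k.2))
  have hm' : ∀ k : Out (fun x => blk x ≠ a), (interpForm blk (interpForm blk Δ (corner ℝ Λc)) s)⁻¹ k.1 k.1 +
      ((interpForm blk (interpForm blk Δ (corner ℝ Λc)) s)⁻¹ *ᵥ ℱ) k.1 ^ 2 ≤ m⁻¹ + (c₂ * F) ^ 2 := fun k =>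
    add_le_add (inv_apply_self_le hA hm hmA k.1) (by rw [← sq_abs]; exact pow_le_pow_left₀ (abs_nonneg _) (hmk k) 2)
  have hm0' : ∀ k : Out (fun x => blk x ≠ a), 0 ≤ (interpForm blk (interpForm blk Δ (corner ℝ Λc)) s)⁻¹ k.1 k.1 +
      ((interpForm blk (interpForm blk Δ (corner ℝ Λc)) s)⁻¹ *ᵥ ℱ) k.1 ^ 2 := fun k =>
    add_nonneg hA.inv.posSemidef.diag_nonneg (sq_nonneg _)
  have hμ0 : 0 ≤ m⁻¹ + (c₂ * F) ^ 2 := add_nonneg (inv_nonneg.2 hm.le) (sq_nonneg _)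
  have hρ0 : 0 ≤ W * (c₁ * δ ^ D * R) := mul_nonneg (Nat.cast_nonneg _) (mul_nonneg (mul_nonneg hc₁ (pow_nonneg hδ0 _)) hR0)
  have hC : 0 ≤ (W * (c₁ * δ ^ D * R)) * ((W * (c₁ * δ ^ D * R)) * (m⁻¹ + (c₂ * F) ^ 2) + c₂ * F * (1 + (m⁻¹ + (c₂ * F) ^ 2))) :=
    by positivity
  refine (majorant_le_of_rows_drift blk (fun x => blk x ≠ a) s n (interpForm blk Δ (corner ℝ Λc)) _ _ _ _ hμ0
    hm' hm0' (fun j => blk j.1 ∈ X'' ∧ ∃ y, blk y = n ∧ Δ y j.1 ≠ 0) hρ0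
    (fun x hx => rowSum_boundary_le_chainN blk hab X'' hnbr hW hR0 hR ds hc₁ hδ0 hδ1 D hgeo Λc hs hs0 hdec x hx)
    (mul_nonneg hc₂ hF0) (fun x _ => hdB x)
    (fun i j => |Δ i.1 j.1|) (fun _ _ => abs_nonneg _) (fun i j _ _ => ?_) (fun i j hi hj hq => ?_)).trans ?_
  · -- the coefficients: `|s_{□y}(Δ_{1_{Λ′}})_{xy}| ≤ |Δ_{xy}|`
    rw [abs_mul, abs_of_nonneg (hs _).1]
    exact (mul_le_of_le_one_left (abs_nonneg _) (hs _).2).trans (abs_interpForm_apply_le blk Δ hcs _ _)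
  · -- the coefficients vanish off the `□_n`-coupled sites of `X″`
    push Not at hq
    by_cases hjX : blk j.1 ∈ X''
    · rw [interpForm_apply_eq_zero blk Δ _ (hq hjX _ hi), mul_zero]
    · rw [hs0 _ hjX, zero_mul]
  · -- the `|Δ|`-weight of the pairs is `≤ W·R`
    have hsum := sum_sum_abs_le blk (fun x => blk x ≠ a) n hW hR0 hR
    calc ∑ i : In (fun x => blk x ≠ a), ∑ j : In (fun x => blk x ≠ a),
          (if blk i.1 = n ∧ blk j.1 ≠ n then |Δ i.1 j.1| else 0) *
            ((W * (c₁ * δ ^ D * R)) * ((W * (c₁ * δ ^ D * R)) * (m⁻¹ + (c₂ * F) ^ 2) + c₂ * F * (1 + (m⁻¹ + (c₂ * F) ^ 2))))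
        = (∑ i : In (fun x => blk x ≠ a), ∑ j : In (fun x => blk x ≠ a),
            if blk i.1 = n ∧ blk j.1 ≠ n then |Δ i.1 j.1| else 0) *
            ((W * (c₁ * δ ^ D * R)) * ((W * (c₁ * δ ^ D * R)) * (m⁻¹ + (c₂ * F) ^ 2) + c₂ * F * (1 + (m⁻¹ + (c₂ * F) ^ 2)))) := by
          simp only [sum_mul]
      _ ≤ (W * R) * ((W * (c₁ * δ ^ D * R)) * ((W * (c₁ * δ ^ D * R)) * (m⁻¹ + (c₂ * F) ^ 2) +
            c₂ * F * (1 + (m⁻¹ + (c₂ * F) ^ 2)))) := mul_le_mul_of_nonneg_right hsum hC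
      _ = _ := rfl

end Literature.MathematicalPhysics.QuantumFieldTheory.BalabanImbrieJaffe1984to88.BIJ88EndChainNFluctSource309

end
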